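import Literature.NumberTheory.GaloisRepresentations.NeukirchLocalAxiomsGalFixing
import Literature.NumberTheory.GaloisRepresentations.DecompositionGroupRelSlim
import Literature.NumberTheory.GaloisRepresentations.PadicAlgebraOfLocalField
import Literature.NumberTheory.Automorphic.AdicCompletionLocalField
import Literature.AnabelianGeometry.AbsoluteAnabelian.NFDecompositionCommTerminalProofs
import Literature.AnabelianGeometry.AbsoluteAnabelian.NFDecompositionNestedProofs
import Literature.AnabelianGeometry.AbsoluteAnabelian.GaloisSubextensionProofs
import Literature.GroupTheory.LocallyConstantCochainTransport
import HarnessLib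

/-!
# The local embedding `Γ_{K_v} ↪ Γ_K` onto a decomposition group `D_A`, and `φ⁻¹(W)`

Topic `NumberTheory/GaloisRepresentations`; namespace
`Literature.NumberTheory.GaloisRepresentations.ExplicitMuCocycles`.  Proof file: theorems only (no
definition, no instance, no named fact).  Classical algebraic number theory: the TRANSPORT DATA for the
number-field instances of the D-side ("local type") hypotheses of abc-iut-w5-d055's abstract Neukirch
theorem ([NSW] Prop. (12.1.9); abc-iut GAP-LEDGER row G-L4d2g4-1, campaign L; holder's spec
`HOME/staging/w5/w5-d055/g7/NF-AXIOM-SPEC.md`).  The four axioms themselves are in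
`NeukirchLocalAxiomsNF.lean`.

SETTING.  `K : Type` a number field, `Γ := Field.absoluteGaloisGroup K`, a nonarchimedean prime of
`K̄` = a valuation subring `A ≠ ⊤` of `K̄ = AlgebraicClosure K` with decomposition group
`D_A := MulAction.stabilizer Γ A` (= `decompositionGroupNF K A`, abc-iut-L4-t4 / w6-d038), `W ≤ Γ` an
open subgroup, `ℓ` a prime, `μ_ℓ` the Galois module `DiscreteGaloisModule.mu`.

* `exists_localEmbedding` — for `A ≠ ⊤` over the finite place `v`: `A ↔ 𝔓 = σ 𝔓₀`
  (`exists_ideal_mem_primesAbove_of_ne_top`, transitivity `exists_smul_eq_of_mem_primesAbove_holds`),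
  and `φ = σ · res_v(·) · σ⁻¹ : Γ_{K_v} → Γ_K` is injective (`absGaloisRestrict_adicCompletion_injective`),
  continuous, has range `D_A` (`decompositionSubgroup_adicCompletionPrime_eq_range`, Neukirch *ANT*
  II (9.6)) and satisfies `ι(σ⁻¹ φ(u) σ y) = u ι(y)` for the chosen embedding `ι : K̄ → F̄_v` of
  algebraic closures (`absClosureEmbedding`);
* `exists_galFixing_eq_comap` — `φ⁻¹(W) = Gal(F̄_v/M)` for a finite subextension `M` of `K_v`;
* `exists_continuousMulEquiv_comap` — `φ⁻¹(W) ≃ₜ* D_A ∩ W` over `φ`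
  (`LocallyConstantCocycles.exists_continuousMulEquiv_subgroupMap`);
* `relIndex_comap_eq` — `[φ⁻¹W : φ⁻¹W'] = [D_A ∩ W : D_A ∩ W']`;
* `smul_eq_self_of_mu_apply_eq_self` / `mu_apply_eq_self_of_forall_smul_eq_self` — fixing the module
  `μ_ℓ(F̄)` ↔ fixing every `ℓ`-th root of unity of `F̄`;
* `mu_apply_eq_self_comap` — `φ⁻¹(W)` fixes `μ_ℓ(F̄_v)` when `W` fixes `μ_ℓ(K̄)`;
* `map_mem_stabilizer_inf`, `pullback_lc_coc` — pull-back of explicit cochains on `D_A ∩ W` along `φ`.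

HONEST FRAMING: classical; nothing here bears on [IUTchIII] Cor. 3.12; no side taken.

## References

* J. Neukirch, *Algebraic Number Theory* (1999), Ch. II §9 (9.6). [NeukirchANT1999]
* J. Neukirch, A. Schmidt, K. Wingberg, *Cohomology of Number Fields* (2nd ed. 2008), XII §1
  Prop. (12.1.9). [NeukirchSchmidtWingberg2008]
* J.-P. Serre, *Galois Cohomology* (1997), I §2.2. [SerreGaloisCohomology1997]
-/

noncomputable section

open scoped NumberField Pointwise
open Field IsDedekindDomain Function

namespace Literature.NumberTheory.GaloisRepresentations.ExplicitMuCocycles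

open Literature.NumberTheory.GaloisRepresentations
open Literature.NumberTheory.GaloisRepresentations.LocalWeilDatum
open Literature.GroupTheory.LocallyConstantCocycles
open Literature.AnabelianGeometry.AbsoluteAnabelian (decompositionGroupNF
  exists_ideal_mem_primesAbove_of_ne_top decompositionGroupNF_eq_decompositionSubgroup
  decompositionGroupNF_eq_stabilizer exists_intermediateField_of_isOpen_absoluteGaloisGroup)
open DiscreteGaloisModule

variable (K : Type) [Field K] [NumberField K]

/-! ### The local embedding `φ = σ · res_v(·) · σ⁻¹ : Γ_{K_v} → Γ_K` attached to `A` -/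

/-- **`D_A = σ res_v(Γ_{K_v}) σ⁻¹`.**  For a nontrivial valuation subring `A` of `K̄` there are a
finite place `v` of `K`, an element `σ ∈ Γ_K` and an injective continuous homomorphism
`φ : Γ_{K_v} → Γ_K` (namely `u ↦ σ · res_v(u) · σ⁻¹`) with range the decomposition group
`D_A = Stab_{Γ_K}(A)`, compatible with the chosen embedding `ι : K̄ → \bar K_v` in the sense
`ι(σ⁻¹ · φ(u) · σ · y) = u · ι(y)` (Neukirch *ANT* II (9.6) `G_w(L|K) ≅ G(L_w|K_v)`; transitivity
of `Γ_K` on the primes above `v`). [cite: NeukirchANT1999, Ch. II §9 Prop. (9.6)] -/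
theorem exists_localEmbedding (A : ValuationSubring (AlgebraicClosure K)) (hA : A ≠ ⊤) :
    ∃ (v : HeightOneSpectrum (𝓞 K)) (σ : absoluteGaloisGroup K)
      (φ : absoluteGaloisGroup (v.adicCompletion K) →* absoluteGaloisGroup K),
      Function.Injective φ ∧ Continuous φ ∧
      φ.range = MulAction.stabilizer (absoluteGaloisGroup K) A ∧
      ∀ (u : absoluteGaloisGroup (v.adicCompletion K)) (y : AlgebraicClosure K),
        absClosureEmbedding K (v.adicCompletion K) (σ⁻¹ • φ u • σ • y) =
          u • absClosureEmbedding K (v.adicCompletion K) y := by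
  obtain ⟨v, 𝔓, h𝔓v, h𝔓⟩ := exists_ideal_mem_primesAbove_of_ne_top A hA
  -- `𝔓 = σ • 𝔓₀`
  obtain ⟨σ, hσ⟩ := HeightOneSpectrum.exists_smul_eq_of_mem_primesAbove_holds (K := K) (v := v)
    (adicCompletionPrime_mem_primesAbove K v) h𝔓v
  let φ : absoluteGaloisGroup (v.adicCompletion K) →* absoluteGaloisGroup K :=
    (MulAut.conj σ).toMonoidHom.comp (absGaloisRestrict K (v.adicCompletion K)).toMonoidHom
  have hφ_apply : ∀ u, φ u = σ * absGaloisRestrict K (v.adicCompletion K) u * σ⁻¹ := fun u => rfl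
  refine ⟨v, σ, φ, ?_, ?_, ?_, ?_⟩
  · exact fun a b hab =>
      absGaloisRestrict_adicCompletion_injective K v ((MulAut.conj σ).injective hab)
  · change Continuous fun x => σ * absGaloisRestrict K (v.adicCompletion K) x * σ⁻¹
    exact ((absGaloisRestrict K (v.adicCompletion K)).continuous.const_mul σ).mul_const σ⁻¹
  · rw [← decompositionGroupNF_eq_stabilizer, decompositionGroupNF_eq_decompositionSubgroup A 𝔓 h𝔓,
      ← hσ, Ideal.decompositionSubgroup_smul, decompositionSubgroup_adicCompletionPrime_eq_range K v]
    ext τ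
    rw [MonoidHom.mem_range, Subgroup.mem_smul_pointwise_iff_exists]
    constructor
    · rintro ⟨x, rfl⟩
      exact ⟨absGaloisRestrict K (v.adicCompletion K) x, ⟨x, rfl⟩, rfl⟩
    · rintro ⟨y, ⟨x, rfl⟩, rfl⟩
      exact ⟨x, rfl⟩
  · intro u y
    rw [hφ_apply, mul_smul, mul_smul, inv_smul_smul, inv_smul_smul, absGaloisRestrict_apply_smul]

/-! ### Consequences for an open `W ≤ Γ_K`: `φ⁻¹(W)` -/

section Comap

variable {K}
variable {v : HeightOneSpectrum (𝓞 K)} {σ : absoluteGaloisGroup K}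
  {φ : absoluteGaloisGroup (v.adicCompletion K) →* absoluteGaloisGroup K}
  (hinj : Function.Injective φ) (hcont : Continuous φ)
  {A : ValuationSubring (AlgebraicClosure K)}
  (hrange : φ.range = MulAction.stabilizer (absoluteGaloisGroup K) A)

include hcont in
/-- `φ⁻¹(W) = Gal(\bar K_v / M)` for a finite subextension `M` of `K_v` (`W` open; infinite Galois
theory for `\bar K_v / K_v`). [cite: NeukirchSchmidtWingberg2008, XII §1 (12.1.9)] -/
theorem exists_galFixing_eq_comap (W : Subgroup (absoluteGaloisGroup K))
    (hW : IsOpen (W : Set (absoluteGaloisGroup K))) :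
    ∃ M : IntermediateField (v.adicCompletion K) (AlgebraicClosure (v.adicCompletion K)),
      FiniteDimensional (v.adicCompletion K) M ∧ galFixing (v.adicCompletion K) M = W.comap φ := by
  haveI : CharZero (v.adicCompletion K) := LocalField.charZero_adicCompletion v
  obtain ⟨M, hMfin, -, hMU⟩ := exists_intermediateField_of_isOpen_absoluteGaloisGroup
    (v.adicCompletion K) (W.comap φ) (hW.preimage hcont)
  exact ⟨M, hMfin, hMU⟩

include hinj hcont hrange in
/-- **`φ⁻¹(W) ≃ₜ* D_A ∩ W` over `φ`** (`φ` a continuous injective homomorphism from the compact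
group `Γ_{K_v}` with range `D_A`). [cite: NeukirchANT1999, Ch. II §9 Prop. (9.6)] -/
theorem exists_continuousMulEquiv_comap (W : Subgroup (absoluteGaloisGroup K))
    (hW : IsOpen (W : Set (absoluteGaloisGroup K))) :
    ∃ e : ↥(W.comap φ) ≃ₜ* ↥(MulAction.stabilizer (absoluteGaloisGroup K) A ⊓ W),
      ∀ u : ↥(W.comap φ), ((e u : ↥(MulAction.stabilizer (absoluteGaloisGroup K) A ⊓ W)) :
        absoluteGaloisGroup K) = φ u := by
  haveI : CharZero (v.adicCompletion K) := LocalField.charZero_adicCompletion v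
  have hclosed : IsClosed ((W.comap φ : Subgroup _) : Set (absoluteGaloisGroup (v.adicCompletion K))) :=
    (W.comap φ).isClosed_of_isOpen (hW.preimage hcont)
  have hmap : (W.comap φ).map φ = MulAction.stabilizer (absoluteGaloisGroup K) A ⊓ W := by
    rw [Subgroup.map_comap_eq, hrange]
  obtain ⟨e, he⟩ := exists_continuousMulEquiv_subgroupMap φ hcont hinj (W.comap φ) hclosed
  rw [← hmap]
  exact ⟨e, he⟩

include hinj in
/-- `[φ⁻¹W : φ⁻¹W'] = [D_A ∩ W : D_A ∩ W']` for `W' ≤ W` (`φ` injective with range `D_A`).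
[cite: NeukirchSchmidtWingberg2008, XII §1 (12.1.9)] -/
theorem relIndex_comap_eq (hrange : φ.range = MulAction.stabilizer (absoluteGaloisGroup K) A)
    (W W' : Subgroup (absoluteGaloisGroup K)) :
    (W'.comap φ).relIndex (W.comap φ) =
      (MulAction.stabilizer (absoluteGaloisGroup K) A ⊓ W').relIndex
        (MulAction.stabilizer (absoluteGaloisGroup K) A ⊓ W) := by
  rw [← Subgroup.relIndex_map_map_of_injective (W'.comap φ) (W.comap φ) hinj,
    Subgroup.map_comap_eq, Subgroup.map_comap_eq, hrange]

end Comap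

/-! ### Roots of unity: `W` fixes `μ_ℓ(K̄)` ⇒ `φ⁻¹(W)` fixes `μ_ℓ(\bar K_v)` -/

section Mu

variable {F : Type*} [Field F] {ℓ : ℕ} [NeZero ℓ]

/-- If `σ ∈ Γ_F` fixes the Galois module `μ_ℓ(F̄)` then it fixes every `ℓ`-th root of unity of `F̄`
(unfolding of `DiscreteGaloisModule.mu`). [cite: SerreLocalFields1979, XIII §3] -/
theorem smul_eq_self_of_mu_apply_eq_self {σ : absoluteGaloisGroup F}
    (h : ∀ z : MuCarrier F ℓ, mu F ℓ σ z = z) {x : AlgebraicClosure F} (hx : x ^ ℓ = 1) :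
    σ • x = x := by
  let r : rootsOfUnity ℓ (AlgebraicClosure F) := rootsOfUnity.mkOfPowEq x hx
  have hr : ((r : (AlgebraicClosure F)ˣ) : AlgebraicClosure F) = x := rfl
  have h1 := congrArg MuCarrier.toAdditive (h (MuCarrier.ofRootsOfUnity r))
  rw [mu_apply_apply] at h1
  have h2 : σ • r = r := Additive.ofMul.injective h1
  have h3 : (((σ • r : rootsOfUnity ℓ (AlgebraicClosure F)) : (AlgebraicClosure F)ˣ) :
      AlgebraicClosure F) = ((r : (AlgebraicClosure F)ˣ) : AlgebraicClosure F) := by rw [h2]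
  rwa [absoluteGaloisGroup.coe_smul_rootsOfUnity, Units.coe_smul, hr] at h3

omit [NeZero ℓ] in
/-- Conversely, if `σ ∈ Γ_F` fixes every `ℓ`-th root of unity of `F̄` then it fixes the Galois module
`μ_ℓ(F̄)`. [cite: SerreLocalFields1979, XIII §3] -/
theorem mu_apply_eq_self_of_forall_smul_eq_self {σ : absoluteGaloisGroup F}
    (h : ∀ x : AlgebraicClosure F, x ^ ℓ = 1 → σ • x = x) (z : MuCarrier F ℓ) :
    mu F ℓ σ z = z := by
  set u : rootsOfUnity ℓ (AlgebraicClosure F) := (MuCarrier.toAdditive z).toMul with hu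
  have hu1 : ((u : (AlgebraicClosure F)ˣ) : AlgebraicClosure F) ^ ℓ = 1 := by
    have h' := u.2
    rw [mem_rootsOfUnity] at h'
    rw [← Units.val_pow_eq_pow_val, h', Units.val_one]
  apply MuCarrier.toAdditive.injective
  rw [mu_apply_apply]
  change Additive.ofMul (σ • u) = Additive.ofMul u
  refine congrArg Additive.ofMul (Subtype.ext (Units.ext ?_))
  rw [absoluteGaloisGroup.coe_smul_rootsOfUnity, Units.coe_smul]
  exact h _ hu1

end Mu

section MuTransport

variable {K}
variable {v : HeightOneSpectrum (𝓞 K)} {σ : absoluteGaloisGroup K}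
  {φ : absoluteGaloisGroup (v.adicCompletion K) →* absoluteGaloisGroup K}
  (hφι : ∀ (u : absoluteGaloisGroup (v.adicCompletion K)) (y : AlgebraicClosure K),
    absClosureEmbedding K (v.adicCompletion K) (σ⁻¹ • φ u • σ • y) =
      u • absClosureEmbedding K (v.adicCompletion K) y)
  {ℓ : ℕ} [hℓ : Fact ℓ.Prime]

include hφι in
/-- **`φ⁻¹(W)` fixes `μ_ℓ(\bar K_v)` when `W` fixes `μ_ℓ(K̄)`**: every `ℓ`-th root of unity of
`\bar K_v` is `ι(ζ₀^i)` for a primitive `ℓ`-th root `ζ₀ ∈ K̄`, and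
`u · ι(ζ₀^i) = ι(σ⁻¹ φ(u) σ ζ₀^i) = ι(ζ₀^i)` since `φ(u) ∈ W` fixes the root of unity `σ ζ₀^i`.
[cite: NeukirchSchmidtWingberg2008, XII §1 (12.1.9)] -/
theorem mu_apply_eq_self_comap (W : Subgroup (absoluteGaloisGroup K))
    (hWμ : ∀ w ∈ W, ∀ z : MuCarrier K ℓ, mu K ℓ w z = z) :
    ∀ u ∈ W.comap φ, ∀ z : MuCarrier (v.adicCompletion K) ℓ, mu (v.adicCompletion K) ℓ u z = z := by
  haveI : NeZero ℓ := ⟨hℓ.out.ne_zero⟩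
  haveI : CharZero (v.adicCompletion K) := LocalField.charZero_adicCompletion v
  intro u hu
  apply mu_apply_eq_self_of_forall_smul_eq_self
  intro x hx
  -- a primitive `ℓ`-th root of unity `ζ₀ ∈ K̄` and its image in `\bar K_v`
  obtain ⟨ζ₀, hζ₀⟩ := HasEnoughRootsOfUnity.prim (M := AlgebraicClosure K) (n := ℓ)
  have hζ₁ : IsPrimitiveRoot (absClosureEmbedding K (v.adicCompletion K) ζ₀) ℓ :=
    hζ₀.map_of_injective (absClosureEmbedding K (v.adicCompletion K)).toRingHom.injective
  obtain ⟨i, -, hi⟩ := hζ₁.eq_pow_of_pow_eq_one hx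
  rw [← hi, ← map_pow, ← hφι u (ζ₀ ^ i)]
  congr 1
  -- `φ u ∈ W` fixes the `ℓ`-th root of unity `σ • ζ₀ ^ i`
  have hw : φ u ∈ W := Subgroup.mem_comap.mp hu
  have hpow : (σ • ζ₀ ^ i) ^ ℓ = 1 := by
    rw [← smul_pow', ← pow_mul, mul_comm, pow_mul, hζ₀.pow_eq_one, one_pow, smul_one]
  rw [smul_eq_self_of_mu_apply_eq_self (hWμ _ hw) hpow, inv_smul_smul]

end MuTransport

/-! ### Pull-back of explicit cochains along `φ` -/

section Pullback

variable {ℓ : ℕ}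

/-- Pull-back bookkeeping: for `φ` with range `D_A` and `a ∈ φ⁻¹(W)`, `φ a ∈ D_A ∩ W`.
[cite: NeukirchSchmidtWingberg2008, XII §1 (12.1.9)] -/
theorem map_mem_stabilizer_inf {v : HeightOneSpectrum (𝓞 K)}
    {φ : absoluteGaloisGroup (v.adicCompletion K) →* absoluteGaloisGroup K}
    {A : ValuationSubring (AlgebraicClosure K)}
    (hrange : φ.range = MulAction.stabilizer (absoluteGaloisGroup K) A)
    {W : Subgroup (absoluteGaloisGroup K)} {a : absoluteGaloisGroup (v.adicCompletion K)}
    (ha : a ∈ W.comap φ) : φ a ∈ MulAction.stabilizer (absoluteGaloisGroup K) A ⊓ W :=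
  ⟨hrange ▸ ⟨a, rfl⟩, Subgroup.mem_comap.mp ha⟩

/-- Pull-back of a cochain on `D_A ∩ W` along `φ` is a cochain on `φ⁻¹(W)` (local constancy and
the cocycle identity), given `e : φ⁻¹(W) ≃ₜ* D_A ∩ W` over `φ`. [cite: SerreGaloisCohomology1997, I §2.2] -/
theorem pullback_lc_coc {v : HeightOneSpectrum (𝓞 K)}
    {φ : absoluteGaloisGroup (v.adicCompletion K) →* absoluteGaloisGroup K}
    {A : ValuationSubring (AlgebraicClosure K)}
    (hrange : φ.range = MulAction.stabilizer (absoluteGaloisGroup K) A)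
    {W : Subgroup (absoluteGaloisGroup K)}
    (e : ↥(W.comap φ) ≃ₜ* ↥(MulAction.stabilizer (absoluteGaloisGroup K) A ⊓ W))
    (he : ∀ u : ↥(W.comap φ),
      ((e u : ↥(MulAction.stabilizer (absoluteGaloisGroup K) A ⊓ W)) : absoluteGaloisGroup K) = φ u)
    (f : absoluteGaloisGroup K → absoluteGaloisGroup K → ZMod ℓ)
    (hflc : IsLocallyConstant
      (fun q : ↥(MulAction.stabilizer (absoluteGaloisGroup K) A ⊓ W) ×
        ↥(MulAction.stabilizer (absoluteGaloisGroup K) A ⊓ W) => f q.1 q.2))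
    (hfcoc : ∀ a ∈ MulAction.stabilizer (absoluteGaloisGroup K) A ⊓ W,
      ∀ b ∈ MulAction.stabilizer (absoluteGaloisGroup K) A ⊓ W,
      ∀ c ∈ MulAction.stabilizer (absoluteGaloisGroup K) A ⊓ W,
        f a b + f (a * b) c = f b c + f a (b * c)) :
    IsLocallyConstant (fun q : ↥(W.comap φ) × ↥(W.comap φ) => f (φ q.1) (φ q.2)) ∧
      ∀ a ∈ W.comap φ, ∀ b ∈ W.comap φ, ∀ c ∈ W.comap φ,
        f (φ a) (φ b) + f (φ (a * b)) (φ c) = f (φ b) (φ c) + f (φ a) (φ (b * c)) := by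
  refine ⟨?_, fun a ha b hb c hc => ?_⟩
  · have heq : (fun q : ↥(W.comap φ) × ↥(W.comap φ) => f (φ q.1) (φ q.2)) =
        (fun q : ↥(MulAction.stabilizer (absoluteGaloisGroup K) A ⊓ W) ×
          ↥(MulAction.stabilizer (absoluteGaloisGroup K) A ⊓ W) => f q.1 q.2) ∘
          fun q => (e q.1, e q.2) := by
      funext q; simp only [Function.comp_apply, he]
    rw [heq]
    exact hflc.comp_continuous
      ((e.continuous.comp continuous_fst).prodMk (e.continuous.comp continuous_snd))
  · rw [map_mul, map_mul]
    exact hfcoc _ (map_mem_stabilizer_inf K hrange ha) _ (map_mem_stabilizer_inf K hrange hb) _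
      (map_mem_stabilizer_inf K hrange hc)

end Pullback

end Literature.NumberTheory.GaloisRepresentations.ExplicitMuCocycles

end
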